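import Literature.NumberTheory.EllipticCurves.Kato2004.EulerSystemClassNonvanishingProofs
import Literature.NumberTheory.EllipticCurves.Kato2004.AdmissibleZetaClassPositionProofs
import Literature.NumberTheory.EllipticCurves.LeadingTermPPartProofs
import Literature.NumberTheory.EllipticCurves.AnalyticRankOrderProofs
import HarnessLib

/-!
# Route `ThetaPartnerAtTwo` (TP2), crux K3 `SignedKatoDivisibilityUpToAtTwo` (stmt-BirchSwinnertonDyer-20308 / K3P′ 25631), line
# `colemanrat` v13, assembly brick B3 — KATO'S CONSTANT IS RATIONAL: the one real constant `κ` of the value law (C5) of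
# `Kato2004.ZetaBody` (fact shape `Kato2004.exists_eulerSystem_expStar_values`) lies in `ℚ` as soon as `L(E,1) ≠ 0`

Width seat `bsd-wall-tp2-p2x-w4` g0 (cell `bsd-wall`), brick B3 of the lead's memo `Cruxes/SignedKatoDivisibilityUpToAtTwo/G7-ASSEMBLY-v1.md`.
HONEST FRAMING: theorems only (no definition, no named fact, no instance, no `sorry`); nothing about Kato's classes is asserted — every
statement is CONDITIONAL on a `ZetaBody` witness family (the conclusion of the cite-only fact); closes no item; K3 / K3P′ are NOT settled
and BSD is NOT proved by any of this.

## What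

The fact `Kato2004.exists_eulerSystem_expStar_values` provides, for `(W, p, f, ι)`, ONE real constant `κ ≠ 0` and ONE datum `Λ` such
that for ALL admissible auxiliary data `(c, d, a, A)` there are classes `z` and values `x` with `ZetaBody W p f ι κ Λ c d a A z x`; its
docstring records that `κ = −Ω⁺Ω⁻/(4π²(f,f))` is NOT asserted rational ("`κ_f ∈ ℚ^×` would be the modular-degree formula, which is NOT in
Kato"). For the K3 assembly (memo §0 step 4–5: `ν := D·κ_den`, `μ := 3κ_num·μ̃ ∈ Λ = ℤ₂⟦T⟧`) the constant must be RATIONAL. It is, by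
the value law itself at the bottom level: choose a guarded datum with non-vanishing four-cusp factor `R⁻ ≠ 0` (tree theorem
`Kato2004.valueGuard_satisfiable`); at level `m = 1`, `χ = 1`, (C4)+(C5) say `x_{0,∅} = r₀ ∈ ℚ` with
`r₀ = κ · L_{(pA)}(f,1)/Ω⁺_f · R⁻` (`Kato2004.zetaBody_value_level_one`), and `L_{(pA)}(f,1)/Ω⁺_f = ∏_{ℓ∣pA}(1 − a_ℓ/ℓ + 𝟙_N(ℓ)/ℓ)·[0]⁺_f`
is a NON-ZERO RATIONAL when `L(E,1) ≠ 0` (`IsNewformOf.entireLFunction_one_eq`: `L(E,1) = [0]⁺Ω⁺`; `eulerFactor_one_ne_zero`).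

* §1 `exists_isDepletedTwistedL_trivial_one_eq`: an entire continuation of the `(M)`-depleted series of the trivial character with its
  VALUE at `1` displayed: `L(1) = (∏_{ℓ ∣ M} Euler_ℓ(1)) · L(E,1)` (`twistedLSeries_one_eq` + `W.entireLFunction`).
* §2 `exists_ratCast_eq_eulerFactors_one`: `∏_{ℓ∈S}(1 − a_ℓ ℓ⁻¹ + 𝟙_N(ℓ) ℓ·ℓ⁻²) = (P₁ : ℚ)` with `P₁ ≠ 0` for the newform of `E`.
* §3 **`exists_ratCast_eq_katoConstant`**: for the newform `f` of `W`, `L(W,1) ≠ 0`, any prime `p`, any embeddings `ι`, any `κ, Λ`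
  with the fact-shaped family `∀ c d a A (guards), ∃ z x, ZetaBody W p f ι κ Λ c d a A z x`: **`∃ q : ℚ, κ = q`**; and the habitat form
  `exists_ratCast_eq_katoConstant_of_analyticRank_eq_zero` (`W.analyticRank = 0`).

References: [Kato2004Asterisque] Thm. 6.6 (1) (p. 163), Thm. 9.7 (p. 189), Ex. 13.3 (p. 225), Lemma 13.10 (1) (p. 230), §6.2 (p. 161);
[MazurTateTeitelbaum1986Invent] §I.8 (8.6).
-/

set_option autoImplicit false
-- the Theorems namespace of this sub repeats the summit name by design (D-0017 nested layout)
set_option linter.dupNamespace false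

noncomputable section

open scoped BigOperators NumberField TensorProduct MatrixGroups

open CongruenceSubgroup Complex WeierstrassCurve IsDedekindDomain
  Literature.NumberTheory.GaloisRepresentations
  Literature.NumberTheory.EllipticCurves Literature.NumberTheory.EllipticCurves.ModularForms
  Literature.NumberTheory.EllipticCurves.Kato2004 Literature.NumberTheory.EllipticCurves.Kato2004.EulerSystemValues

namespace Summit.BirchSwinnertonDyer.BirchSwinnertonDyer.Theorems.SignedKatoOffTwo.KatoConst

variable {W : WeierstrassCurve ℚ} [W.IsElliptic] {N : ℕ} [NeZero N] {f : CuspForm (Gamma0 N) 2}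

/-! ## §1 A continuation of the depleted trivial-character series with its value at `1` displayed -/

omit [W.IsElliptic] in
/-- **The `(M)`-depleted `L`-series of the trivial character, continued with a known value at `1`.** For the newform `f` of `W`,
`m = 1` and `M ≥ 1`: `L(s) := ∏_{ℓ ∣ 1·M}(1 − a_ℓ ℓ^{−s} + 𝟙_N(ℓ) ℓ·ℓ^{−2s}) · L(W, s)` is an entire continuation of
`Σ_{(n,M)=1} a_n n^{−s}` (`IsDepletedTwistedL f m M 1 L`, via `twistedLSeries_one_eq`), so `L(1) = ∏_ℓ Euler_ℓ(1) · L(W,1)`.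
[cite: Kato2004Asterisque, §6.2 (p. 161)] -/
theorem exists_isDepletedTwistedL_trivial_one_eq (hf : IsNewformOf W f) {m : ℕ} [NeZero m] (hm : m = 1)
    (M : ℕ) [NeZero M] :
    ∃ L : ℂ → ℂ, IsDepletedTwistedL f m M (1 : DirichletCharacter ℂ m) L ∧
      L 1 = (∏ ℓ ∈ (m * M).primeFactors, (1 - cuspCoeff f ℓ * (ℓ : ℂ) ^ (-(1 : ℂ)) +
        (if ℓ ∣ N then 0 else (ℓ : ℂ)) * ((ℓ : ℂ) ^ (-(1 : ℂ))) ^ 2)) * W.entireLFunction 1 := by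
  subst hm
  haveI : NeZero (1 * M) := ⟨by rw [one_mul]; exact NeZero.ne M⟩
  have hE : W.HasEntireLFunction := hf.hasEntireLFunction
  set P : ℂ → ℂ := fun s ↦ ∏ ℓ ∈ (1 * M).primeFactors, (1 - cuspCoeff f ℓ * (ℓ : ℂ) ^ (-s) +
    (if ℓ ∣ N then 0 else (ℓ : ℂ)) * ((ℓ : ℂ) ^ (-s)) ^ 2) with hP
  have ht : ∀ ℓ ∈ (1 * M).primeFactors, Differentiable ℂ fun s : ℂ => (ℓ : ℂ) ^ (-s) := fun ℓ hℓ =>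
    differentiable_neg.const_cpow (Or.inl (Nat.cast_ne_zero.mpr (Nat.prime_of_mem_primeFactors hℓ).ne_zero))
  have hPd : Differentiable ℂ P := by
    rw [hP]
    exact Differentiable.fun_finsetProd (𝕜 := ℂ) (u := (1 * M).primeFactors)
      (f := fun (ℓ : ℕ) (s : ℂ) => 1 - cuspCoeff f ℓ * (ℓ : ℂ) ^ (-s) +
        (if ℓ ∣ N then 0 else (ℓ : ℂ)) * ((ℓ : ℂ) ^ (-s)) ^ 2)
      fun ℓ hℓ => ((differentiable_const _).sub ((differentiable_const _).mul (ht ℓ hℓ))).add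
        ((differentiable_const _).mul ((ht ℓ hℓ).pow 2))
  refine ⟨fun s ↦ P s * W.entireLFunction s, ⟨hPd.mul (W.differentiable_entireLFunction hE), fun s hs ↦ ?_⟩, rfl⟩
  have hs' : (3 / 2 : ℝ) < s.re := by
    have : (2 : ℝ) < s.re := hs
    linarith
  change P s * W.entireLFunction s = _
  rw [DirichletCharacter.changeLevel_one, twistedLSeries_one_eq hf.1 (1 * M) hs, hf.cuspFormLSeries_eq,
    W.entireLFunction_eq_LSeries hE hs']

/-! ## §2 The removed Euler factors at `s = 1` are a non-zero rational number -/

/-- **`∏_{ℓ∈S}(1 − a_ℓ ℓ⁻¹ + 𝟙_N(ℓ) ℓ·ℓ⁻²) ∈ ℚ ∖ {0}`** for the newform `f` of `W/ℚ` and a finite set `S` of primes: the coefficients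
`a_ℓ(f) = a_ℓ(W)` are integers (`IsNewformOf`), and no factor vanishes (`eulerFactor_one_ne_zero`: `|a_ℓ| ≤ 2√ℓ`, resp. `a_ℓ ∈ {0,±1}`).
[cite: Kato2004Asterisque, §6.2 (p. 161)] [cite: SilvermanAEC2009, Thm. V.1.1] -/
theorem exists_ratCast_eq_eulerFactors_one (hf : IsNewformOf W f) (S : Finset ℕ) (hS : ∀ ℓ ∈ S, ℓ.Prime) :
    ∃ P₁ : ℚ, P₁ ≠ 0 ∧
      (∏ ℓ ∈ S, (1 - cuspCoeff f ℓ * (ℓ : ℂ) ^ (-(1 : ℂ)) + (if ℓ ∣ N then 0 else (ℓ : ℂ)) * ((ℓ : ℂ) ^ (-(1 : ℂ))) ^ 2)) =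
        (P₁ : ℂ) := by
  refine ⟨∏ ℓ ∈ S, eulerFactorAtOne W N ℓ,
    Finset.prod_ne_zero_iff.mpr fun ℓ hℓ ↦ eulerFactorAtOne_ne_zero W hf (hS ℓ hℓ), ?_⟩
  rw [Rat.cast_prod]
  refine Finset.prod_congr rfl fun ℓ hℓ ↦ ?_
  have hℓ0 : (ℓ : ℂ) ≠ 0 := Nat.cast_ne_zero.mpr (hS ℓ hℓ).ne_zero
  rw [hf.2 ℓ, cpow_neg_one]
  unfold eulerFactorAtOne
  split_ifs
  · push_cast
    field_simp
    ring
  · push_cast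
    field_simp

/-! ## §3 Kato's constant is rational -/

/-- **Kato's constant is rational.** Let `f` be the newform of `W/ℚ` with `L(W,1) ≠ 0`, `p` any prime, `ι` any family of complex
embeddings of the cyclotomic fields, and `(κ, Λ)` a constant and a dual-exponential datum such that for ALL admissible `(c, d, a, A)`
(`A ≥ 1`, `(c, 6pA) = 1`, `(d, 6pN) = 1`) there are classes and values with `ZetaBody W p f ι κ Λ c d a A z x` (the shape of the
conclusion of `Kato2004.exists_eulerSystem_expStar_values`). Then `κ ∈ ℚ`. Proof: take Kato's guarded datum with `R⁻ ≠ 0`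
(`valueGuard_satisfiable`); the level-`1` value `x_{0,∅} = r₀ ∈ ℚ` equals `κ·L_{(pA)}(f,1)/Ω⁺·R⁻` (`zetaBody_value_level_one` with the
continuation of §1), and `L_{(pA)}(f,1)/Ω⁺·R⁻ = P₁·[0]⁺·R⁻ ∈ ℚ ∖ {0}` (§2, `IsNewformOf.entireLFunction_one_eq`, `cuspFactor_one_eq_ratCuspFactor`).
CONDITIONAL on the `ZetaBody` family (nothing about Kato's classes is asserted here).
[cite: Kato2004Asterisque, Thm. 6.6 (1) (p. 163), Thm. 9.7 (p. 189), Ex. 13.3 (p. 225)] [cite: MazurTateTeitelbaum1986Invent, §I.8 (8.6)] -/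
theorem exists_ratCast_eq_katoConstant (hf : IsNewformOf W f) (hL1 : W.entireLFunction 1 ≠ 0) (p : ℕ) [Fact p.Prime]
    [ContinuousSMul ℤ_[p] (W.tateModule p)] [Module.Free ℤ_[p] (W.tateModule p)] [Module.Finite ℤ_[p] (W.tateModule p)]
    {ι : (m : ℕ) → (CyclotomicField m ℚ →+* ℂ)} {κ : ℝ}
    {Λ : ∀ (k : ℕ) (r : Finset (HeightOneSpectrum (𝓞 ℚ))),
      H1 (tateRep W p) (cycSubgroup p k r) →ₗ[ℤ_[p]] ℚ_[p] ⊗[ℚ] CyclotomicField (cycLevel p k r) ℚ}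
    (hfam : ∀ (c d a : ℤ) (A : ℕ), 0 < A → Int.gcd c (6 * p * A) = 1 → Int.gcd d (6 * p * N) = 1 →
      ∃ (z : ∀ (k : ℕ) (r : (cyclotomicLevelsRat p (badPlaces c d A N)).Ideals),
            H1 (tateRep W p) ((cyclotomicLevelsRat p (badPlaces c d A N)).level k r.1))
        (x : ∀ (k : ℕ) (r : (cyclotomicLevelsRat p (badPlaces c d A N)).Ideals),
            CyclotomicField (cycLevel p k r.1) ℚ),
        ZetaBody W p f ι κ Λ c d a A z x) :
    ∃ q : ℚ, κ = q := by
  have hp : p.Prime := Fact.out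
  obtain ⟨c, d, a, A, d', hA, hc, hd, hcd, hdd', hR⟩ := valueGuard_satisfiable f hf.1 hf.coeffField_eq_bot p
  obtain ⟨z, x, hbody⟩ := hfam c d a A hA hc hd
  haveI : NeZero A := ⟨hA.ne'⟩
  haveI : NeZero (p * A) := ⟨mul_ne_zero hp.ne_zero hA.ne'⟩
  -- the continuation of §1 at `m = cycLevel p 0 ∅ = 1`, `M = pA`
  obtain ⟨L, hL, hL1eq⟩ := exists_isDepletedTwistedL_trivial_one_eq hf
    (show cycLevel p 0 (∅ : Finset (HeightOneSpectrum (𝓞 ℚ))) = 1 by rw [cycLevel, pow_zero, Finset.prod_empty, mul_one]) (p * A)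
  obtain ⟨r₀, -, hr₀⟩ := zetaBody_value_level_one hbody d' hcd hdd' hL
  -- the Euler factors at `1` are a non-zero rational
  obtain ⟨P₁, hP₁0, hP₁⟩ := exists_ratCast_eq_eulerFactors_one hf ((cycLevel p 0 ∅ * (p * A)).primeFactors)
    (fun ℓ hℓ ↦ Nat.prime_of_mem_primeFactors hℓ)
  -- `L(W,1) = [0]⁺ Ω⁺`, `Ω⁺ > 0`, `[0]⁺ ≠ 0`
  have hΩ : 0 < plusPeriod f := IsNewform0.plusPeriod_pos_holds hf.1 hf.coeffField_eq_bot
  have hLval : W.entireLFunction 1 = ((ratPlusSymbol f 0 : ℚ) : ℂ) * (plusPeriod f : ℂ) := by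
    rw [hf.entireLFunction_one_eq]; push_cast; ring
  have hsym0 : ratPlusSymbol f 0 ≠ 0 := by
    intro h0
    apply hL1
    rw [hLval, h0, Rat.cast_zero, zero_mul]
  have hRrat : ratCuspFactor f true c d a A d' ≠ 0 := by
    intro h0
    apply hR
    rw [cuspFactor_one_eq_ratCuspFactor, h0, Rat.cast_zero]
  -- `r₀ = κ · X`, `X = P₁ · [0]⁺ · R⁻ ∈ ℚ ∖ {0}`
  set X : ℚ := P₁ * ratPlusSymbol f 0 * ratCuspFactor f true c d a A d' with hX
  have hX0 : X ≠ 0 := mul_ne_zero (mul_ne_zero hP₁0 hsym0) hRrat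
  have hkey : (r₀ : ℂ) = (κ : ℂ) * (X : ℂ) := by
    rw [hr₀, hL1eq, hP₁, hLval, cuspFactor_one_eq_ratCuspFactor, hX]
    have hΩc : (plusPeriod f : ℂ) ≠ 0 := by exact_mod_cast hΩ.ne'
    field_simp
    push_cast
    ring
  refine ⟨r₀ / X, ?_⟩
  have hκc : (κ : ℂ) = ((r₀ / X : ℚ) : ℂ) := by
    have hXc : (X : ℂ) ≠ 0 := by exact_mod_cast hX0
    rw [Rat.cast_div, eq_div_iff hXc, ← hkey]
  have h := congrArg Complex.re hκc
  rw [Complex.ofReal_re] at h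
  rw [h, ← Complex.ofReal_ratCast, Complex.ofReal_re]

/-- **Kato's constant is rational on the habitat** (`W.analyticRank = 0`, so `L(W,1) ≠ 0` by `analyticRank_eq_zero_iff`-type bookkeeping:
`W.entireLFunction 1 ≠ 0`). Same statement as `exists_ratCast_eq_katoConstant` with the hypothesis `hL1` replaced by `W.analyticRank = 0`.
[cite: Kato2004Asterisque, Thm. 6.6 (1) (p. 163), Thm. 9.7 (p. 189)] -/
theorem exists_ratCast_eq_katoConstant_of_analyticRank_eq_zero (hf : IsNewformOf W f) (hr : W.analyticRank = 0)
    (p : ℕ) [Fact p.Prime]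
    [ContinuousSMul ℤ_[p] (W.tateModule p)] [Module.Free ℤ_[p] (W.tateModule p)] [Module.Finite ℤ_[p] (W.tateModule p)]
    {ι : (m : ℕ) → (CyclotomicField m ℚ →+* ℂ)} {κ : ℝ}
    {Λ : ∀ (k : ℕ) (r : Finset (HeightOneSpectrum (𝓞 ℚ))),
      H1 (tateRep W p) (cycSubgroup p k r) →ₗ[ℤ_[p]] ℚ_[p] ⊗[ℚ] CyclotomicField (cycLevel p k r) ℚ}
    (hfam : ∀ (c d a : ℤ) (A : ℕ), 0 < A → Int.gcd c (6 * p * A) = 1 → Int.gcd d (6 * p * N) = 1 →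
      ∃ (z : ∀ (k : ℕ) (r : (cyclotomicLevelsRat p (badPlaces c d A N)).Ideals),
            H1 (tateRep W p) ((cyclotomicLevelsRat p (badPlaces c d A N)).level k r.1))
        (x : ∀ (k : ℕ) (r : (cyclotomicLevelsRat p (badPlaces c d A N)).Ideals),
            CyclotomicField (cycLevel p k r.1) ℚ),
        ZetaBody W p f ι κ Λ c d a A z x) :
    ∃ q : ℚ, κ = q :=
  exists_ratCast_eq_katoConstant hf
    ((WeierstrassCurve.analyticRank_eq_zero_iff_holds (W := W) hf.hasEntireLFunction).mp hr) p hfam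

end Summit.BirchSwinnertonDyer.BirchSwinnertonDyer.Theorems.SignedKatoOffTwo.KatoConst

end
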